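import Summits.QuantumFields.BalabanUV.T4Continuum.Spine.NE9.DirectPairingApexAnalytic
import Summits.QuantumFields.BalabanUV.T4Continuum.Spine.NE9.DirectPairingApex
import Literature.MathematicalPhysics.QuantumFieldTheory.Balaban1983to89.T4DressingDefect

/-!
# T⁴ programme, spine estimate NE9 — THE RATE AT THE APEX, ANALYTIC CURRENCY (SCHEME half): the Wilson-loop expectations inherit the King route's
# generating-function rate UP TO A LOGARITHM, `∣⟨∏W⟩_{K₀+K} − E∣ ≤ e·η_K·log(M∕η_K)∕(l·log 2)`, `η_K = 2·vol·Δ_K` — census item C45 (c) of cell `pub-balaban-gaps`,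
# seat ne9 (gen 14)

Cell `pub-balaban-gaps` (YM blitz G2, seat ne9, unit `pub-balaban-gaps-ne9-g14`; record `run/shared/lean/pub/pub-balaban-gaps/ne/NE9.md` §5 row C45).  Junction of
`DirectPairingApexAnalytic` (MODEL: three lines on the ellipse + Cauchy) with the tree's apex vocabulary (`Missing.TorusScheme.expectAt`,
`T4GenFunBounds.schemeZ` ∕ `prodObs` ∕ `gibbsMeasure` ∕ `differentiable_complexMGF_scheme` ∕ `deriv_complexMGF_scheme_zero` ∕ `genFun_schemeZ_eq_cgf`,
`T4DressingDefect.norm_complexMGF_sub_one_le`, `DirectPairingCauchy.abs_genFun_add_sub_le`).  NO definition; nothing of Bałaban's asserted.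
* `clog_complexMGF_bounds`: for `∣X∣ ≤ 1` a.e. under a probability measure, `z ↦ log(complexMGF X μ z)` is
  differentiable on `‖z‖ < 1∕2` and bounded by `3∕4` on `‖z‖ ≤ 1∕4` (`‖complexMGF z − 1‖ ≤ 2‖z‖`, `Complex.norm_log_one_add_half_le_self`).
* `expectAt_rate_of_king_analytic`: for a scheme with `β_K ≥ 0` and measurable observables bounded by `1`, King's per-string socket (EXACTLY the datum of
  `DirectPairingApex.stringwiseGenFunCauchy_of_king`) ⇒ with `l = min(l₀, 1∕5)`, `Y = log 2` (`cosh Y = 5∕4`: the ellipse sits in `‖z‖ ≤ 1∕4`), `M = 3∕2`,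
  `η_K = 2·vol·Δ_K`: `∣⟨∏W⟩_{K₀+K+n} − ⟨∏W⟩_{K₀+K}∣ ≤ η_K^{1−y∕Y}·M^{y∕Y}∕(l·sinh y)` for every `y ∈ ]0, Y]` and all `n`, and a limit `E` with the same bound;
  `expectAt_rate_of_king_analytic_log`: `∣⟨∏W⟩_{K₀+K} − E∣ ≤ e·η_K·log(M∕η_K)∕(l·log 2)` whenever `0 < η_K ≤ M∕e`.

VERDICT FOR THE ROW (census C45 (c)).  At the apex the King route loses NO EXPONENT: the continuum-limit error of the Wilson-loop EXPECTATION is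
`≤ C·vol·Δ_K·log(1∕(vol·Δ_K))` with `Δ_K` the explicit generating-function remainder of C44 — a geometric ratio `r` per step stays `r` (times a factor linear in
`K`), polynomial exponents are kept up to a logarithm; the losses `1∕2` (convexity, sharp in ITS currency) and `2∕3` (third cumulant) of (a)∕(b) were properties
of those currencies, not of the programme.  NOTHING new is owed by the E-side (holomorphy and the uniform bound are properties of every bounded observable);
CLASSIFICATION OF NE9 UNCHANGED: WORK-bound (W1 = the one-step renormalization transformation as a Lean object; instance 0∕1).

HONEST FRAMING: bookkeeping for rung (B)+1 on ONE FIXED finite four-torus; a junction with the tree's apex vocabulary under King's matching SHAPE — the cell's located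
estimate, NOT in print for Bałaban's d = 4 procedure; every bound is a MODEL-level formula, not a certified constant of Bałaban's; NE9 NOT PRINTED ∕ NOT PROVED;
spine PROVED 0∕9 unchanged; instance 0∕1; NOT UV stability, NOT the continuum limit, NOT infinite volume, NOT a mass gap, NOT Clay.  DEPENDENCY: continuum YM on
T⁴ ⇐ BetaPertH ∧ nine spine estimates (0∕9 proved).

References (TYPES only): [King1986] = C. King, Commun. Math. Phys. **102** (1986) 649–677, Thm 3.4 (3.9) p. 656, (3.13) p. 657; [JaffeWittenClay2006] §6.5 p. 11.
-/

namespace Summit.QuantumFields.BalabanUV.T4Continuum.NE9.DirectPairingApexAnalyticScheme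

open Complex Set Filter Topology MeasureTheory ProbabilityTheory Metric
open Literature.MathematicalPhysics.QuantumFieldTheory.Balaban1983to89
open T4CauchySum (genFun)
open Missing (TorusScheme)
open Summit.QuantumFields.BalabanUV.T4Continuum.NE9.DirectPairingCauchy (abs_genFun_add_sub_le)
open Summit.QuantumFields.BalabanUV.T4Continuum.NE9.DirectPairingApexAnalytic
  (norm_deriv_le_interp interp_at_log limit_le_of_pairBound' tendsto_of_pairBound')

section Scheme

variable {G : Type*} [GaugeGroup G] [MeasurableSpace G] [RegularGaugeGroup G] [HaarData G] {O : Type*}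

/-- **THE COMPLEX CUMULANT GENERATING FUNCTION OF A BOUNDED OBSERVABLE NEAR THE REAL AXIS**: for a probability measure and `∣X∣ ≤ 1` a.e.:
`z ↦ log (complexMGF X μ z)` is differentiable on `‖z‖ < 1∕2` and bounded by `3∕4` on `‖z‖ ≤ 1∕4` (`‖complexMGF z − 1‖ ≤ 2‖z‖`,
`T4DressingDefect.norm_complexMGF_sub_one_le`; `Complex.norm_log_one_add_half_le_self`). [folklore] -/
theorem clog_complexMGF_bounds {Ω : Type*} [MeasurableSpace Ω] {μ : Measure Ω} [IsProbabilityMeasure μ] {X : Ω → ℝ}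
    (hX : AEMeasurable X μ) (hB : ∀ᵐ ω ∂μ, |X ω| ≤ 1) :
    DifferentiableOn ℂ (fun z => Complex.log (complexMGF X μ z)) (ball (0 : ℂ) (1 / 2)) ∧
      ∀ z : ℂ, ‖z‖ ≤ 1 / 4 → ‖Complex.log (complexMGF X μ z)‖ ≤ 3 / 4 := by
  have hsub1 : ∀ z : ℂ, ‖z‖ ≤ 1 → ‖complexMGF X μ z - 1‖ ≤ 2 * ‖z‖ := fun z hz => by
    simpa using T4DressingDefect.norm_complexMGF_sub_one_le (B := 1) hX hB (z := z) (by simpa using hz)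
  have hdiff : Differentiable ℂ (complexMGF X μ) :=
    T4GenFunBounds.differentiable_complexMGF_of_abs_le hX hB
  constructor
  · intro z hz
    rw [mem_ball, dist_zero_right] at hz
    have hlt : ‖complexMGF X μ z - 1‖ < 1 := by linarith [hsub1 z (by linarith)]
    have hsl : complexMGF X μ z ∈ slitPlane := by
      have := mem_slitPlane_of_norm_lt_one hlt
      rwa [add_sub_cancel] at this
    exact ((hdiff z).clog hsl).differentiableWithinAt
  · intro z hz
    have hu : ‖complexMGF X μ z - 1‖ ≤ 1 / 2 := by linarith [hsub1 z (by linarith)]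
    have := Complex.norm_log_one_add_half_le_self hu
    rw [add_sub_cancel] at this
    linarith

/-- **THE RATE AT THE APEX WITH NO POLYNOMIAL LOSS.**  For a scheme with `β_K ≥ 0` and measurable observables bounded by `1`, and ONE string `os` carrying
King's socket (`l₀ > 0`, `vol`, offset `K₀`, remainders `Δ_K → 0`, `∣log Z_{K₀+K+n}(t) − log Z_{K₀+K}(t) − c∣ ≤ vol·Δ_K` on `∣t∣ ≤ l₀` — EXACTLY the datum of
`DirectPairingApex.stringwiseGenFunCauchy_of_king`): with `l = min(l₀, 1∕5)`, `Y = log 2`, `M = 3∕2`, `η_K = 2·vol·Δ_K`, for every `y ∈ ]0, log 2]`, `K`, `n`: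
`∣S.expectAt (K₀+K+n) os − S.expectAt (K₀+K) os∣ ≤ η_K^{1−y∕Y}·M^{y∕Y}∕(l·sinh y)`; the expectations converge to some `E` with the same bound for
`∣S.expectAt (K₀+K) os − E∣`.  (Three lines on the ellipse for `D = log complexMGF_{K₀+K+n} − log complexMGF_{K₀+K}`, holomorphic on `‖z‖ < 1∕2`, `‖D‖ ≤ 3∕2`
on the ellipse ⊆ `‖z‖ ≤ 1∕4`, `‖D‖ ≤ η_K` on `[−l, l]` by `DirectPairingCauchy.abs_genFun_add_sub_le`; `D′(0)` = the difference of the expectations by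
`T4GenFunBounds.deriv_complexMGF_scheme_zero`.)  CONDITIONAL kernel theorem on a hypothesis SHAPE (King's matching).
[cite: King1986, Thm 3.4 (3.9) p. 656, p. 657] [folklore] -/
theorem expectAt_rate_of_king_analytic (S : TorusScheme G O) (hβ : ∀ K, 0 ≤ S.β K)
    (hm : ∀ K o, Measurable (S.obs K o)) (h1 : ∀ K o U, |S.obs K o U| ≤ 1) (os : List O)
    {l₀ vol : ℝ} {K₀ : ℕ} {Δ : ℕ → ℝ} (hl₀ : 0 < l₀) (hΔ : Tendsto Δ atTop (𝓝 0))
    (hU5 : ∀ K n : ℕ, ∃ c : ℝ, ∀ t : ℝ, |t| ≤ l₀ →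
      |Real.log (T4GenFunBounds.schemeZ S os (K₀ + (K + n)) t) -
          Real.log (T4GenFunBounds.schemeZ S os (K₀ + K) t) - c| ≤ vol * Δ K) :
    (∀ K n y, 0 < y → y ≤ Real.log 2 →
        |S.expectAt (K₀ + (K + n)) os - S.expectAt (K₀ + K) os| ≤
          (2 * (vol * Δ K)) ^ (1 - y / Real.log 2) * (3 / 2 : ℝ) ^ (y / Real.log 2) / (min l₀ (1 / 5) * Real.sinh y)) ∧
      ∃ E : ℝ, Tendsto (fun K => S.expectAt K os) atTop (𝓝 E) ∧
        ∀ K y, 0 < y → y ≤ Real.log 2 →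
          |S.expectAt (K₀ + K) os - E| ≤
            (2 * (vol * Δ K)) ^ (1 - y / Real.log 2) * (3 / 2 : ℝ) ^ (y / Real.log 2) / (min l₀ (1 / 5) * Real.sinh y) := by
  -- abbreviations
  set l : ℝ := min l₀ (1 / 5) with hl
  have hlpos : 0 < l := lt_min hl₀ (by norm_num)
  have hl5 : l ≤ 1 / 5 := min_le_right _ _
  have hll₀ : l ≤ l₀ := min_le_left _ _
  have hY : 0 < Real.log 2 := Real.log_pos one_lt_two
  have hcoshY : Real.cosh (Real.log 2) = 5 / 4 := by
    rw [Real.cosh_eq, Real.exp_log two_pos, Real.exp_neg, Real.exp_log two_pos]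
    norm_num
  haveI hP : ∀ K, IsProbabilityMeasure (T4GenFunBounds.gibbsMeasure (G := G) (S.P K) (S.β K)) := fun K =>
    T4GenFunBounds.isProbabilityMeasure_gibbsMeasure (S.P K) (hβ K)
  have hXm : ∀ K, AEMeasurable (T4GenFunBounds.prodObs S K os) (T4GenFunBounds.gibbsMeasure (S.P K) (S.β K)) :=
    fun K => (T4GenFunBounds.measurable_prodObs S hm K os).aemeasurable
  have hXb : ∀ K, ∀ᵐ U ∂(T4GenFunBounds.gibbsMeasure (G := G) (S.P K) (S.β K)), |T4GenFunBounds.prodObs S K os U| ≤ 1 :=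
    fun K => Eventually.of_forall (T4GenFunBounds.abs_prodObs_le_one S h1 K os)
  -- the complex cumulant generating functions of the product observables
  set L : ℕ → ℂ → ℂ := fun K z =>
    Complex.log (complexMGF (T4GenFunBounds.prodObs S K os) (T4GenFunBounds.gibbsMeasure (S.P K) (S.β K)) z) with hL
  have hLd : ∀ K, DifferentiableOn ℂ (L K) (ball (0 : ℂ) (1 / 2)) := fun K => (clog_complexMGF_bounds (hXm K) (hXb K)).1
  have hLb : ∀ K z, ‖z‖ ≤ 1 / 4 → ‖L K z‖ ≤ 3 / 4 := fun K => (clog_complexMGF_bounds (hXm K) (hXb K)).2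
  -- at a real point `L K` is node U6's generating function
  have hLreal : ∀ K (t : ℝ), L K t = ((genFun (T4GenFunBounds.schemeZ S os) K t : ℝ) : ℂ) := by
    intro K t
    have hmgfpos : 0 < mgf (T4GenFunBounds.prodObs S K os) (T4GenFunBounds.gibbsMeasure (S.P K) (S.β K)) t :=
      mgf_pos (T4GenFunBounds.integrable_exp_mul_of_bound (hXm K) (hXb K) t)
    show Complex.log (complexMGF _ _ (t : ℂ)) = _
    rw [complexMGF_ofReal, ← Complex.ofReal_log hmgfpos.le, T4GenFunBounds.genFun_schemeZ_eq_cgf S hβ hm h1 K os t]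
    rfl
  -- `L K` has derivative `S.expectAt K os` at `0`
  have hLderiv : ∀ K, HasDerivAt (L K) ((S.expectAt K os : ℝ) : ℂ) 0 := by
    intro K
    have hd : HasDerivAt (complexMGF (T4GenFunBounds.prodObs S K os) (T4GenFunBounds.gibbsMeasure (S.P K) (S.β K)))
        ((S.expectAt K os : ℝ) : ℂ) 0 := by
      have := ((T4GenFunBounds.differentiable_complexMGF_scheme S hβ hm h1 K os) 0).hasDerivAt
      rwa [T4GenFunBounds.deriv_complexMGF_scheme_zero S hβ hm h1 K os] at this
    have h0 : complexMGF (T4GenFunBounds.prodObs S K os) (T4GenFunBounds.gibbsMeasure (S.P K) (S.β K)) 0 = 1 := by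
      simp [complexMGF]
    have hsl : complexMGF (T4GenFunBounds.prodObs S K os) (T4GenFunBounds.gibbsMeasure (S.P K) (S.β K)) 0 ∈ slitPlane := by
      rw [h0]
      exact one_mem_slitPlane
    have := hd.clog hsl
    rw [h0, div_one] at this
    exact this
  -- geometry: the ellipse `l·cos{∣Im∣ ≤ log 2}` sits in `‖z‖ ≤ 1∕4`
  have hell : ∀ z : ℂ, |z.im| ≤ Real.log 2 → ‖(l : ℂ) * Complex.cos z‖ ≤ 1 / 4 := by
    intro z hz
    rw [norm_mul, Complex.norm_real, Real.norm_eq_abs, abs_of_pos hlpos]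
    -- `‖cos z‖ ≤ cosh (Im z)` (the tree's `GammaVerticalBounds.norm_cos_le_cosh_im`, re-derived inline to keep the import cone topic-local)
    have hcz : ‖Complex.cos z‖ ≤ Real.cosh z.im := by
      have h := norm_add_le (Complex.exp (z * I)) (Complex.exp (-z * I))
      rw [← Complex.two_cos, norm_mul, Complex.norm_two, Complex.norm_exp, Complex.norm_exp] at h
      have e1 : (z * I).re = -z.im := by simp
      have e2 : (-z * I).re = z.im := by simp
      rw [e1, e2] at h
      rw [Real.cosh_eq]
      linarith
    have hc : ‖Complex.cos z‖ ≤ 5 / 4 := by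
      calc ‖Complex.cos z‖ ≤ Real.cosh z.im := hcz
        _ ≤ Real.cosh (Real.log 2) := Real.cosh_le_cosh.mpr (by rwa [abs_of_pos hY])
        _ = 5 / 4 := hcoshY
    nlinarith [norm_nonneg (Complex.cos z)]
  have hmem : ∀ z : ℂ, |z.im| ≤ Real.log 2 → (l : ℂ) * Complex.cos z ∈ ball (0 : ℂ) (1 / 2) := fun z hz => by
    rw [mem_ball, dist_zero_right]
    linarith [hell z hz]
  -- the pair bound: three lines on the ellipse + Cauchy for `D = L (K₀+K+n) − L (K₀+K)`
  have hpair : ∀ K n y, 0 < y → y ≤ Real.log 2 →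
      |S.expectAt (K₀ + (K + n)) os - S.expectAt (K₀ + K) os| ≤
        (2 * (vol * Δ K)) ^ (1 - y / Real.log 2) * (3 / 2 : ℝ) ^ (y / Real.log 2) / (l * Real.sinh y) := by
    intro K n y hy0 hyY
    have hDd : DifferentiableOn ℂ (fun z => L (K₀ + (K + n)) z - L (K₀ + K) z) (ball (0 : ℂ) (1 / 2)) :=
      (hLd _).sub (hLd _)
    have hM : ∀ z : ℂ, |z.im| ≤ Real.log 2 →
        ‖(fun z => L (K₀ + (K + n)) z - L (K₀ + K) z) ((l : ℂ) * Complex.cos z)‖ ≤ 3 / 2 :=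
      fun z hz => (norm_sub_le _ _).trans (by linarith [hLb (K₀ + (K + n)) _ (hell z hz), hLb (K₀ + K) _ (hell z hz)])
    have hη : ∀ x : ℝ, ‖(fun z => L (K₀ + (K + n)) z - L (K₀ + K) z) ((l : ℂ) * Complex.cos x)‖ ≤ 2 * (vol * Δ K) := by
      intro x
      have e : (l : ℂ) * Complex.cos x = ((l * Real.cos x : ℝ) : ℂ) := by
        rw [Complex.ofReal_mul, Complex.ofReal_cos]
      have ht : |l * Real.cos x| ≤ l₀ := by
        rw [abs_mul, abs_of_pos hlpos]
        nlinarith [Real.abs_cos_le_one x, abs_nonneg (Real.cos x)]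
      show ‖L (K₀ + (K + n)) ((l : ℂ) * Complex.cos x) - L (K₀ + K) ((l : ℂ) * Complex.cos x)‖ ≤ _
      rw [e, hLreal, hLreal, ← Complex.ofReal_sub, Complex.norm_real, Real.norm_eq_abs]
      have := abs_genFun_add_sub_le (Z := fun K => T4GenFunBounds.schemeZ S os (K₀ + K)) hU5 hl₀.le K n ht
      simpa only [genFun, add_assoc] using this
    have hη0 : 0 ≤ 2 * (vol * Δ K) := (norm_nonneg _).trans (hη 0)
    have hderiv := norm_deriv_le_interp isOpen_ball hDd hlpos hY hmem hM hη hη0 hy0 hyY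
    have hD0' : HasDerivAt (fun z => L (K₀ + (K + n)) z - L (K₀ + K) z)
        (((S.expectAt (K₀ + (K + n)) os : ℝ) : ℂ) - ((S.expectAt (K₀ + K) os : ℝ) : ℂ)) 0 :=
      (hLderiv _).sub (hLderiv _)
    have hD0 : deriv (fun z => L (K₀ + (K + n)) z - L (K₀ + K) z) 0 =
        ((S.expectAt (K₀ + (K + n)) os - S.expectAt (K₀ + K) os : ℝ) : ℂ) := by
      rw [Complex.ofReal_sub]
      exact hD0'.deriv
    rw [hD0, Complex.norm_real, Real.norm_eq_abs] at hderiv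
    exact hderiv
  refine ⟨hpair, ?_⟩
  -- convergence, from the bound at the fixed level `y = log 2 ∕ 2`
  have hy2 : 0 < Real.log 2 / 2 := by positivity
  have hy2' : Real.log 2 / 2 ≤ Real.log 2 := by linarith
  have hb0 : Tendsto (fun K => (2 * (vol * Δ K)) ^ (1 - Real.log 2 / 2 / Real.log 2) * (3 / 2 : ℝ) ^ (Real.log 2 / 2 / Real.log 2) /
      (l * Real.sinh (Real.log 2 / 2))) atTop (𝓝 0) := by
    have hη : Tendsto (fun K => 2 * (vol * Δ K)) atTop (𝓝 0) := by simpa using (hΔ.const_mul vol).const_mul 2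
    have hexp : (1 : ℝ) - Real.log 2 / 2 / Real.log 2 = 1 / 2 := by
      field_simp
      ring
    rw [hexp]
    have h1 := hη.rpow_const (p := (1 / 2 : ℝ)) (Or.inr (by norm_num))
    rw [Real.zero_rpow (by norm_num)] at h1
    simpa using (h1.mul_const ((3 / 2 : ℝ) ^ (Real.log 2 / 2 / Real.log 2))).div_const (l * Real.sinh (Real.log 2 / 2))
  obtain ⟨E, hE⟩ := tendsto_of_pairBound' (e := fun K => S.expectAt (K₀ + K) os) (fun K n => by
    simpa only [add_assoc] using hpair K n _ hy2 hy2') hb0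
  refine ⟨E, ?_, fun K y hy0 hyY => ?_⟩
  · have hE' : Tendsto (fun K => S.expectAt (K + K₀) os) atTop (𝓝 E) := hE.congr fun K => by simp only [add_comm]
    exact (tendsto_add_atTop_iff_nat K₀).1 hE'
  · exact limit_le_of_pairBound' (e := fun K => S.expectAt (K₀ + K) os) (fun n => by
      simpa only [add_assoc] using hpair K n y hy0 hyY) hE

/-- **… IN CLOSED FORM: `∣⟨∏W⟩_{K₀+K} − E∣ ≤ e·η_K·log(M∕η_K)∕(l·log 2)`** with `η_K = 2·vol·Δ_K`, `M = 3∕2`, `l = min(l₀, 1∕5)`, whenever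
`0 < η_K ≤ M∕e` — the generating-function rate up to a LOGARITHM (`interp_at_log` at `y = log 2∕log(M∕η_K)`).  CONDITIONAL kernel theorem on a hypothesis
SHAPE (King's matching). [cite: King1986, Thm 3.4 (3.9) p. 656, p. 657] [folklore] -/
theorem expectAt_rate_of_king_analytic_log (S : TorusScheme G O) (hβ : ∀ K, 0 ≤ S.β K)
    (hm : ∀ K o, Measurable (S.obs K o)) (h1 : ∀ K o U, |S.obs K o U| ≤ 1) (os : List O)
    {l₀ vol : ℝ} {K₀ : ℕ} {Δ : ℕ → ℝ} (hl₀ : 0 < l₀) (hΔ : Tendsto Δ atTop (𝓝 0))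
    (hU5 : ∀ K n : ℕ, ∃ c : ℝ, ∀ t : ℝ, |t| ≤ l₀ →
      |Real.log (T4GenFunBounds.schemeZ S os (K₀ + (K + n)) t) -
          Real.log (T4GenFunBounds.schemeZ S os (K₀ + K) t) - c| ≤ vol * Δ K) :
    ∃ E : ℝ, Tendsto (fun K => S.expectAt K os) atTop (𝓝 E) ∧
      ∀ K, 0 < vol * Δ K → Real.exp 1 * (2 * (vol * Δ K)) ≤ 3 / 2 →
        |S.expectAt (K₀ + K) os - E| ≤
          Real.exp 1 * (2 * (vol * Δ K)) * Real.log (3 / 2 / (2 * (vol * Δ K))) / (min l₀ (1 / 5) * Real.log 2) := by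
  obtain ⟨-, E, hE, hb⟩ := expectAt_rate_of_king_analytic S hβ hm h1 os hl₀ hΔ hU5
  refine ⟨E, hE, fun K hpos hsmall => ?_⟩
  have hη0 : 0 < 2 * (vol * Δ K) := by positivity
  obtain ⟨hy0, hyY, hle⟩ := interp_at_log (l := min l₀ (1 / 5)) (Y := Real.log 2) (M := 3 / 2) hη0 hsmall
    (Real.log_pos one_lt_two) (lt_min hl₀ (by norm_num))
  exact (hb K _ hy0 hyY).trans hle

end Scheme

end Summit.QuantumFields.BalabanUV.T4Continuum.NE9.DirectPairingApexAnalyticScheme
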